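import Summits.HubbardSuperconductivity.HubbardSuperconductivity.Theorems.WeakCouplingBCSKlLindhardEnclosureGate
import Literature.MathematicalPhysics.QuantumLattice.AnisotropicBandFermiCurveMeasure

/-!
# KL-MARGIN-SCAN reader (22) «kernel-lindhard-enclosure» — STRUCTURAL SOUNDNESS OF THE FLOOR: `FloorSoundAt P t` from per-leaf soundness

The round-11 instrument (`…KlLindhardEnclosure{Cos,Records,Kernel,Gate,CertW20A/B/C}`, idea-4 r11, packaging p1 g24/g25) states every
enclosure MODULO the two typed, unproved, prover-owned predicates `FloorSoundAt P t` / `CeilSoundAt P t` (Gate §4).  This file discharges the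
TREE part of the floor predicate once and for all: the fused kernel evaluation `QB.eval` only ever SUMS leaf floor terms over structurally
disjoint half-open sub-cells of the root square, so `FloorSoundAt P t` holds for EVERY certificate tree `t` as soon as each LEAF floor term is
sound on its own cell (`LeafFloorSoundAt P`, stated below — the per-rule analytic debt: Jensen floor on two-shell squares, boundary floor on
single-straddle cells; zero floor elsewhere).  Ingredients: additivity and monotonicity of the set integral of the non-negative two-shell
integrand over disjoint half-open boxes, the midpoint/cut bookkeeping of `QB.eval`, and `[−π, π)² ⊆` the root square for admissible `P`.
Honest framing: a reduction, not a discharge — `LeafFloorSoundAt` is NOT proved here; floats are floats; nothing in this file asserts a KL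
margin at any `t′ ≠ 0`, `K₃`, `U₀`, the window or B1g dominance; a Kohn–Luttinger instability statement is not ODLRO and nothing here proves
superconductivity in the Hubbard model.  (p1 g25, 2026-08-29.)
-/

noncomputable section

set_option linter.dupNamespace false

namespace Summit.HubbardSuperconductivity.HubbardSuperconductivity.Theorems.KlLindhardEnclosure

open Real Set MeasureTheory Literature.MathematicalPhysics.QuantumLattice
open Summit.HubbardSuperconductivity.HubbardSuperconductivity.Theorems

/-! ## §1 Cells: measurability, the BZ-part of the cell integral, splitting -/

/-- The real abscissa of grid coordinate `z`: `z/U` (the cast of `P.toQ z`). -/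
theorem Params.cast_toQ (P : Params) (z : ℤ) : ((P.toQ z : ℚ) : ℝ) = (z : ℝ) / (P.U : ℝ) := by
  simp [Params.toQ]

/-- `z ↦ z/U` is monotone for `0 < U`. -/
theorem Params.cast_toQ_mono (P : Params) (hU : 0 < P.U) {z z' : ℤ} (h : z ≤ z') :
    ((P.toQ z : ℚ) : ℝ) ≤ ((P.toQ z' : ℚ) : ℝ) := by
  rw [P.cast_toQ, P.cast_toQ]
  have hU' : (0 : ℝ) < (P.U : ℝ) := by exact_mod_cast hU
  exact div_le_div_of_nonneg_right (by exact_mod_cast h) hU'.le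

/-- The first coordinate is measurable on `Momentum`. -/
theorem measurable_coord0 : Measurable fun p : Momentum => p 0 :=
  (PiLp.continuous_apply 2 (fun _ : Fin 2 => ℝ) 0).measurable

/-- The second coordinate is measurable on `Momentum`. -/
theorem measurable_coord1 : Measurable fun p : Momentum => p 1 :=
  (PiLp.continuous_apply 2 (fun _ : Fin 2 => ℝ) 1).measurable

/-- A grid cell is the intersection of two coordinate preimages of half-open intervals. -/
theorem Params.cellSet_eq (P : Params) (a b c d : ℤ) :
    P.cellSet a b c d = (fun p : Momentum => p 0) ⁻¹' Ico (((P.toQ a : ℚ) : ℝ)) (((P.toQ b : ℚ) : ℝ)) ∩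
      (fun p : Momentum => p 1) ⁻¹' Ico (((P.toQ c : ℚ) : ℝ)) (((P.toQ d : ℚ) : ℝ)) := by
  ext p
  simp only [Params.cellSet, mem_setOf_eq, mem_inter_iff, mem_preimage, mem_Ico]
  tauto

/-- Grid cells are measurable. -/
theorem Params.measurableSet_cellSet (P : Params) (a b c d : ℤ) : MeasurableSet (P.cellSet a b c d) := by
  rw [P.cellSet_eq]
  exact (measurableSet_Ico.preimage measurable_coord0).inter (measurableSet_Ico.preimage measurable_coord1)

/-- The BZ-part of the integral of the two-shell integrand over the grid cell `[a/U, b/U) × [c/U, d/U)`. -/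
def Params.cellIntBZ (P : Params) (a b c d : ℤ) : ℝ :=
  ∫ p in P.cellSet a b c d ∩ brillouinZone, P.integrand p

/-- The two-shell integrand is non-negative. -/
theorem Params.integrand_nonneg (P : Params) (p : Momentum) : 0 ≤ P.integrand p :=
  lindhardIntegrand_nonneg _ _ _ p

/-- The BZ-part of a cell integral is non-negative. -/
theorem Params.cellIntBZ_nonneg (P : Params) (a b c d : ℤ) : 0 ≤ P.cellIntBZ a b c d :=
  setIntegral_nonneg ((P.measurableSet_cellSet a b c d).inter brillouinZone_measurableSet) fun p _ => P.integrand_nonneg p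

/-- Monotonicity of the BZ-part of the integral under inclusion of measurable sets inside the zone. -/
theorem Params.setIntegral_mono_of_subset (P : Params) (hint : IntegrableOn P.integrand brillouinZone volume)
    {A S : Set Momentum} (hS : S ⊆ brillouinZone) (hAS : A ⊆ S) :
    ∫ p in A, P.integrand p ≤ ∫ p in S, P.integrand p :=
  setIntegral_mono_set (hint.mono_set hS) (Filter.Eventually.of_forall fun p => P.integrand_nonneg p)
    (Filter.Eventually.of_forall hAS)

/-- Splitting a cell at an abscissa `m` between its ends (in either order) can only lose mass (non-negative integrand, disjoint pieces). -/
theorem Params.cellIntBZ_split_x (P : Params) (hU : 0 < P.U) (hint : IntegrableOn P.integrand brillouinZone volume)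
    {a m b : ℤ} (hm : (a ≤ m ∧ m ≤ b) ∨ (b ≤ m ∧ m ≤ a)) (c d : ℤ) :
    P.cellIntBZ a m c d + P.cellIntBZ m b c d ≤ P.cellIntBZ a b c d := by
  unfold Params.cellIntBZ
  set A := P.cellSet a m c d ∩ brillouinZone with hA
  set B := P.cellSet m b c d ∩ brillouinZone with hB
  set S := P.cellSet a b c d ∩ brillouinZone with hS
  have hdisj : Disjoint A B := by
    rw [Set.disjoint_left]
    intro p hpA hpB
    simp only [hA, hB, Params.cellSet, mem_inter_iff, mem_setOf_eq] at hpA hpB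
    linarith [hpA.1.2.1, hpB.1.1]
  have hBm : MeasurableSet B := (P.measurableSet_cellSet m b c d).inter brillouinZone_measurableSet
  have hAS : A ∪ B ⊆ S := by
    intro p hp
    simp only [hA, hB, hS, Params.cellSet, mem_inter_iff, mem_setOf_eq, mem_union] at hp ⊢
    rcases hm with ⟨h1, h2⟩ | ⟨h1, h2⟩
    · have e1 := P.cast_toQ_mono hU h1
      have e2 := P.cast_toQ_mono hU h2
      rcases hp with ⟨⟨h01, h02, h03, h04⟩, hz⟩ | ⟨⟨h01, h02, h03, h04⟩, hz⟩
      · exact ⟨⟨h01, lt_of_lt_of_le h02 e2, h03, h04⟩, hz⟩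
      · exact ⟨⟨le_trans e1 h01, h02, h03, h04⟩, hz⟩
    · have e1 := P.cast_toQ_mono hU h1
      have e2 := P.cast_toQ_mono hU h2
      rcases hp with ⟨⟨h01, h02, h03, h04⟩, hz⟩ | ⟨⟨h01, h02, h03, h04⟩, hz⟩
      · exact absurd (lt_of_lt_of_le (lt_of_le_of_lt h01 h02) e2) (lt_irrefl _)
      · exact absurd (lt_of_lt_of_le (lt_of_le_of_lt h01 h02) e1) (lt_irrefl _)
  have hSsub : S ⊆ brillouinZone := inter_subset_right
  have hintA : IntegrableOn P.integrand A volume := hint.mono_set ((subset_union_left).trans (hAS.trans hSsub))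
  have hintB : IntegrableOn P.integrand B volume := hint.mono_set ((subset_union_right).trans (hAS.trans hSsub))
  rw [← setIntegral_union hdisj hBm hintA hintB]
  exact P.setIntegral_mono_of_subset hint hSsub hAS

/-- Splitting a cell at an ordinate `m` between its ends (in either order) can only lose mass. -/
theorem Params.cellIntBZ_split_y (P : Params) (hU : 0 < P.U) (hint : IntegrableOn P.integrand brillouinZone volume)
    (a b : ℤ) {c m d : ℤ} (hm : (c ≤ m ∧ m ≤ d) ∨ (d ≤ m ∧ m ≤ c)) :
    P.cellIntBZ a b c m + P.cellIntBZ a b m d ≤ P.cellIntBZ a b c d := by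
  unfold Params.cellIntBZ
  set A := P.cellSet a b c m ∩ brillouinZone with hA
  set B := P.cellSet a b m d ∩ brillouinZone with hB
  set S := P.cellSet a b c d ∩ brillouinZone with hS
  have hdisj : Disjoint A B := by
    rw [Set.disjoint_left]
    intro p hpA hpB
    simp only [hA, hB, Params.cellSet, mem_inter_iff, mem_setOf_eq] at hpA hpB
    linarith [hpA.1.2.2.2, hpB.1.2.2.1]
  have hBm : MeasurableSet B := (P.measurableSet_cellSet a b m d).inter brillouinZone_measurableSet
  have hAS : A ∪ B ⊆ S := by
    intro p hp
    simp only [hA, hB, hS, Params.cellSet, mem_inter_iff, mem_setOf_eq, mem_union] at hp ⊢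
    rcases hm with ⟨h1, h2⟩ | ⟨h1, h2⟩
    · have e1 := P.cast_toQ_mono hU h1
      have e2 := P.cast_toQ_mono hU h2
      rcases hp with ⟨⟨h01, h02, h03, h04⟩, hz⟩ | ⟨⟨h01, h02, h03, h04⟩, hz⟩
      · exact ⟨⟨h01, h02, h03, lt_of_lt_of_le h04 e2⟩, hz⟩
      · exact ⟨⟨h01, h02, le_trans e1 h03, h04⟩, hz⟩
    · have e1 := P.cast_toQ_mono hU h1
      have e2 := P.cast_toQ_mono hU h2
      rcases hp with ⟨⟨h01, h02, h03, h04⟩, hz⟩ | ⟨⟨h01, h02, h03, h04⟩, hz⟩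
      · exact absurd (lt_of_lt_of_le (lt_of_le_of_lt h03 h04) e2) (lt_irrefl _)
      · exact absurd (lt_of_lt_of_le (lt_of_le_of_lt h03 h04) e1) (lt_irrefl _)
  have hSsub : S ⊆ brillouinZone := inter_subset_right
  have hintA : IntegrableOn P.integrand A volume := hint.mono_set ((subset_union_left).trans (hAS.trans hSsub))
  have hintB : IntegrableOn P.integrand B volume := hint.mono_set ((subset_union_right).trans (hAS.trans hSsub))
  rw [← setIntegral_union hdisj hBm hintA hintB]
  exact P.setIntegral_mono_of_subset hint hSsub hAS

/-- An integer midpoint lies between the two ends, in either order. -/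
theorem midpoint_between (a b : ℤ) : (a ≤ (a + b) / 2 ∧ (a + b) / 2 ≤ b) ∨ (b ≤ (a + b) / 2 ∧ (a + b) / 2 ≤ a) := by
  omega

/-! ## §2 Per-leaf floor soundness and the structural theorem -/

/-- **PER-LEAF FLOOR SOUNDNESS at `P`** (the analytic debt, leaf rule by leaf rule): for every leaf cell of the grid with corner records built
by `mkX/mkY` and every hint payload, if the two-shell integrand is integrable on the zone then the leaf's FLOOR term (units `2^-30`) is at most
`2^30 ·` the BZ-part of the cell integral.  (Zero floor terms — certified same-side cells, tip cells, cells not inside `[−piLoZ, piLoZ)²`,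
failed guards — satisfy it trivially; the content is the Jensen floor `floorInside` and the boundary floor `floorBdry`.) [folklore] -/
def LeafFloorSoundAt (P : Params) : Prop :=
  ∀ (bd : Option (ℕ × ℕ × ℕ × ℕ)) (tp : Option (ℕ × ℕ × ℕ × ℕ × ℕ × ℕ × ℕ × ℕ)) (a b c d : ℤ),
    IntegrableOn P.integrand brillouinZone volume →
      (((P.leaf bd tp (P.mkX a) (P.mkX b) (P.mkY c) (P.mkY d)).1 : ℤ) : ℝ) ≤ 2 ^ 30 * P.cellIntBZ a b c d

/-- **TREE INDUCTION**: under per-leaf floor soundness, the fused floor sum of ANY certificate tree on ANY cell with `mkX/mkY` corner records is at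
most `2^30 ·` the BZ-part of that cell's integral. -/
theorem eval_fst_le_cellIntBZ (P : Params) (hU : 0 < P.U) (hleaf : LeafFloorSoundAt P)
    (hint : IntegrableOn P.integrand brillouinZone volume) (t : QB) :
    ∀ a b c d : ℤ, (((t.eval P (P.mkX a) (P.mkX b) (P.mkY c) (P.mkY d)).1 : ℤ) : ℝ) ≤ 2 ^ 30 * P.cellIntBZ a b c d := by
  induction t with
  | o => intro a b c d; simpa [QB.eval] using hleaf none none a b c d hint
  | d σx σy τx τy => intro a b c d; simpa [QB.eval] using hleaf (some (σx, σy, τx, τy)) none a b c d hint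
  | w a1 a2 a3 a4 a5 a6 a7 a8 =>
      intro a b c d; simpa [QB.eval] using hleaf none (some (a1, a2, a3, a4, a5, a6, a7, a8)) a b c d hint
  | n c00 c10 c01 c11 ih00 ih10 ih01 ih11 =>
      intro a b c d
      have h00 := ih00 a ((a + b) / 2) c ((c + d) / 2)
      have h10 := ih10 ((a + b) / 2) b c ((c + d) / 2)
      have h01 := ih01 a ((a + b) / 2) ((c + d) / 2) d
      have h11 := ih11 ((a + b) / 2) b ((c + d) / 2) d
      have hx1 := P.cellIntBZ_split_x hU hint (midpoint_between a b) c ((c + d) / 2)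
      have hx2 := P.cellIntBZ_split_x hU hint (midpoint_between a b) ((c + d) / 2) d
      have hy := P.cellIntBZ_split_y hU hint a b (midpoint_between c d)
      simp only [QB.eval, Params.mkX_z, Params.mkY_z, Int.cast_add]
      linarith
  | cx z l r ihl ihr =>
      intro a b c d
      simp only [QB.eval, Params.mkX_z]
      split_ifs with h
      · have hl := ihl a z c d
        have hr := ihr z b c d
        have hx := P.cellIntBZ_split_x hU hint (Or.inl ⟨h.1.le, h.2.le⟩) c d
        simp only [Int.cast_add]
        linarith
      · simp only [Int.cast_zero]
        have := P.cellIntBZ_nonneg a b c d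
        positivity
  | cy z l r ihl ihr =>
      intro a b c d
      simp only [QB.eval, Params.mkY_z]
      split_ifs with h
      · have hl := ihl a b c z
        have hr := ihr a b z d
        have hy := P.cellIntBZ_split_y hU hint a b (Or.inl ⟨h.1.le, h.2.le⟩)
        simp only [Int.cast_add]
        linarith
      · simp only [Int.cast_zero]
        have := P.cellIntBZ_nonneg a b c d
        positivity
  | bx l r ihl ihr =>
      intro a b c d
      have hl := ihl a ((a + b) / 2) c d
      have hr := ihr ((a + b) / 2) b c d
      have hx := P.cellIntBZ_split_x hU hint (midpoint_between a b) c d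
      simp only [QB.eval, Params.mkX_z, Int.cast_add]
      linarith
  | bY l r ihl ihr =>
      intro a b c d
      have hl := ihl a b c ((c + d) / 2)
      have hr := ihr a b ((c + d) / 2) d
      have hy := P.cellIntBZ_split_y hU hint a b (midpoint_between c d)
      simp only [QB.eval, Params.mkY_z, Int.cast_add]
      linarith

/-- Admissibility gives a positive grid unit. -/
theorem Params.U_pos_of_admissible (P : Params) (hP : P.admissible = true) : 0 < P.U := by
  simp only [Params.admissible, Bool.and_eq_true, decide_eq_true_eq] at hP
  exact hP.1.1.1.1.1.1.2

/-- Admissibility gives `π ≤ Xz/U`: the root square `[−Xz/U, Xz/U)²` covers `[−π, π)²`. -/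
theorem Params.pi_le_Xz_div_U (P : Params) (hP : P.admissible = true) : π ≤ (P.Xz : ℝ) / (P.U : ℝ) := by
  simp only [Params.admissible, Bool.and_eq_true, decide_eq_true_eq] at hP
  have hU : 0 < P.U := hP.1.1.1.1.1.1.2
  have h1 : 3141593 * P.U ≤ P.piUpZ * 1000000 := hP.1.1.1.1.2
  have h2 : P.piUpZ ≤ P.Xz := hP.1.1.2
  have hU' : (0 : ℝ) < (P.U : ℝ) := by exact_mod_cast hU
  have h1' : (3141593 : ℝ) * (P.U : ℝ) ≤ (P.piUpZ : ℝ) * 1000000 := by exact_mod_cast h1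
  have h2' : (P.piUpZ : ℝ) ≤ (P.Xz : ℝ) := by exact_mod_cast h2
  rw [le_div_iff₀ hU']
  have hpi := Real.pi_lt_d6
  nlinarith

/-- For admissible `P` the zone lies inside the root square, so the BZ-part of the root-cell integral is the whole zone integral. -/
theorem Params.cellIntBZ_root (P : Params) (hP : P.admissible = true) :
    P.cellIntBZ (-P.Xz) P.Xz (-P.Xz) P.Xz = ∫ p in brillouinZone, P.integrand p := by
  unfold Params.cellIntBZ
  have hset : P.cellSet (-P.Xz) P.Xz (-P.Xz) P.Xz ∩ brillouinZone = brillouinZone := by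
    apply Set.inter_eq_right.mpr
    intro p hp
    have hπ := P.pi_le_Xz_div_U hP
    have h0 := hp 0
    have h1 := hp 1
    simp only [mem_Ico] at h0 h1
    simp only [Params.cellSet, mem_setOf_eq, P.cast_toQ, Int.cast_neg, neg_div]
    refine ⟨?_, ?_, ?_, ?_⟩ <;> linarith [h0.1, h0.2, h1.1, h1.2]
  rw [hset]

/-- **STRUCTURAL FLOOR SOUNDNESS**: per-leaf floor soundness at `P` implies `FloorSoundAt P t` for EVERY certificate tree `t`. -/
theorem floorSoundAt_of_leafFloorSound (P : Params) (hleaf : LeafFloorSoundAt P) (t : QB) : FloorSoundAt P t := by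
  intro hP hint
  have hU := P.U_pos_of_admissible hP
  have key := eval_fst_le_cellIntBZ P hU hleaf hint t (-P.Xz) P.Xz (-P.Xz) P.Xz
  rw [P.cellIntBZ_root hP] at key
  exact key

end Summit.HubbardSuperconductivity.HubbardSuperconductivity.Theorems.KlLindhardEnclosure

end
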